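import Literature.Probability.LatticeModels.PlusStateHeatBath
import HarnessLib

/-!
# Stein covariance identity `⟨M_N · Σ_{x∈Λ_N} Ψ^A_x⟩ = |Λ_N| · c_A`

Stub `stub_steinCovariance` (S1) of the line `Sketch` (idea `stein-cramer-rao-dual-witness`) for the
crux `SubPtolemyFloor` (stmt-CriticalPhenomena-15703, route decl
`Summit.CriticalPhenomena.Ising3DConformalLimit.Theses.SubPtolemyInterlacing.SubPtolemyFloor`).

Notation: `β ≥ 0`, `⟨·⟩ = plusExpect d β 0` (the plus state), `S_x σ = ∑_{y ∼ x} σ_y`,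
`t_x = tanh(β S_x)`, the DLR score `g_x = σ_x − t_x`; for a local functional `A` reading the finite set
`K ∌ 0`, `A_x σ = A (σ(· + x))` and the Stein field `Ψ^A_x = A_x g_x`. The identity proved here
(for every `d`, every `β ≥ 0`, then specialised to `d = 3`, `β = β_c(3)`):

  `⟨(Σ_{y∈Λ_N} σ_y) · Σ_{x∈Λ_N} A_x g_x⟩ = |Λ_N| · ⟨A (1 − t_0²)⟩`,  `Λ_N = box d N`.

Proof: expand into `Σ_{y,x} ⟨σ_y A_x g_x⟩` (linearity of the plus state on local observables, through
the plus Gibbs measure `exists_plusMeasure_integral_eq_plusExpect`). Off the diagonal (`y ≠ x`) the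
term vanishes: the score `g_x` is centred against the local functional `σ_y A_x`, which does not read
`σ_x` because `0 ∉ K` (`plusExpect_score_mul_eq_zero`). On the diagonal `σ_x² = 1` gives
`σ_x A_x g_x = A_x − σ_x (t_x A_x)`, the heat-bath identity `plusExpect_spinAt_mul_eq_tanh` turns
`⟨σ_x t_x A_x⟩` into `⟨t_x² A_x⟩`, so the term is `⟨A_x (1 − t_x²)⟩ = ⟨A (1 − t_0²)⟩` by translation
invariance (`plusExpect_comp_add`, `sum_neighborFinset_zdGraph_eq_sum_add`).
-/

noncomputable section

namespace Summit.CriticalPhenomena.Ising3DConformalLimit.SubPtolemyFloorStein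

open Finset MeasureTheory Literature.Probability.LatticeModels

/-! ### `DependsOn` bookkeeping -/

/-- The product of two local observables is local (it reads the union of the two supports). [folklore] -/
theorem cov_dependsOn_mul {d : ℕ} {F G : SpinConfig (Site d) → ℝ} {D₁ D₂ : Finset (Site d)}
    (hF : DependsOn F (↑D₁ : Set (Site d))) (hG : DependsOn G (↑D₂ : Set (Site d))) :
    DependsOn (fun σ : SpinConfig (Site d) => F σ * G σ) (↑(D₁ ∪ D₂) : Set (Site d)) :=
  fun σ τ hst => by
    dsimp only
    rw [hF fun i hi => hst i (Finset.mem_coe.2 (Finset.mem_union_left _ (Finset.mem_coe.1 hi))),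
      hG fun i hi => hst i (Finset.mem_coe.2 (Finset.mem_union_right _ (Finset.mem_coe.1 hi)))]

/-- The difference of two local observables is local (it reads the union of the two supports). [folklore] -/
theorem cov_dependsOn_sub {d : ℕ} {F G : SpinConfig (Site d) → ℝ} {D₁ D₂ : Finset (Site d)}
    (hF : DependsOn F (↑D₁ : Set (Site d))) (hG : DependsOn G (↑D₂ : Set (Site d))) :
    DependsOn (fun σ : SpinConfig (Site d) => F σ - G σ) (↑(D₁ ∪ D₂) : Set (Site d)) :=
  fun σ τ hst => by
    dsimp only
    rw [hF fun i hi => hst i (Finset.mem_coe.2 (Finset.mem_union_left _ (Finset.mem_coe.1 hi))),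
      hG fun i hi => hst i (Finset.mem_coe.2 (Finset.mem_union_right _ (Finset.mem_coe.1 hi)))]

/-- The spin `σ_x` reads only the site `x`. [folklore] -/
theorem cov_dependsOn_spinAt {d : ℕ} (x : Site d) :
    DependsOn (fun σ : SpinConfig (Site d) => spinAt x σ)
      (↑({x} : Finset (Site d)) : Set (Site d)) :=
  fun σ τ hst => by
    dsimp only
    simp only [spinAt, hst x (Finset.mem_coe.2 (Finset.mem_singleton_self x))]

/-- The conditional mean `tanh(β ∑_{y∼x} σ_y)` reads only the neighbours of `x`. [folklore] -/
theorem cov_dependsOn_tanh {d : ℕ} (β : ℝ) (x : Site d) :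
    DependsOn (fun σ : SpinConfig (Site d) =>
        Real.tanh (β * ∑ w ∈ (zdGraph d).neighborFinset x, spinAt w σ))
      (↑((zdGraph d).neighborFinset x) : Set (Site d)) :=
  fun σ τ hst => by
    have e : ∑ w ∈ (zdGraph d).neighborFinset x, spinAt w σ =
        ∑ w ∈ (zdGraph d).neighborFinset x, spinAt w τ :=
      Finset.sum_congr rfl fun w hw => by simp only [spinAt, hst w (Finset.mem_coe.2 hw)]
    dsimp only
    rw [e]

/-- A finite sum of local observables is local (it reads the union of the supports). [folklore] -/
theorem cov_dependsOn_finset_sum {d : ℕ} {ι : Type*} (s : Finset ι) (D : ι → Finset (Site d))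
    {F : ι → SpinConfig (Site d) → ℝ} (hF : ∀ i ∈ s, DependsOn (F i) (↑(D i) : Set (Site d))) :
    DependsOn (fun σ : SpinConfig (Site d) => ∑ i ∈ s, F i σ) (↑(s.biUnion D) : Set (Site d)) :=
  fun _ _ hst => Finset.sum_congr rfl fun i hi => hF i hi fun y hy =>
    hst y (Finset.mem_coe.2 (Finset.mem_biUnion.2 ⟨i, hi, Finset.mem_coe.1 hy⟩))

/-! ### Linearity of the plus state on local observables -/

/-- **Linearity of the plus state on finite sums of local observables**: for `β ≥ 0` and local
`F_i`, `⟨∑_{i∈s} F_i⟩⁺_{β,h} = ∑_{i∈s} ⟨F_i⟩⁺_{β,h}` (the plus state integrates local observables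
against the plus Gibbs measure, `exists_plusMeasure_integral_eq_plusExpect`). [folklore] -/
theorem cov_plusExpect_finset_sum {d : ℕ} {β : ℝ} (hβ : 0 ≤ β) (h : ℝ) {ι : Type*} (s : Finset ι)
    (D : ι → Finset (Site d)) (F : ι → SpinConfig (Site d) → ℝ)
    (hF : ∀ i ∈ s, DependsOn (F i) (↑(D i) : Set (Site d))) :
    plusExpect d β h (fun σ => ∑ i ∈ s, F i σ) = ∑ i ∈ s, plusExpect d β h (F i) := by
  obtain ⟨μ, _, -, -, -, hμE⟩ := exists_plusMeasure_integral_eq_plusExpect (d := d) hβ h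
  rw [hμE _ _ (cov_dependsOn_finset_sum s D hF),
    integral_finsetSum s fun i hi => integrable_of_dependsOn_finset μ (D i) (hF i hi)]
  exact Finset.sum_congr rfl fun i hi => (hμE (D i) (F i) (hF i hi)).symm

/-! ### The two kinds of terms -/

/-- **Off-diagonal terms vanish**: for `y ≠ x`, `⟨σ_y A_x g_x⟩⁺_{β,0} = 0` — the DLR score
`g_x = σ_x − tanh(β S_x)` is centred against the local functional `σ_y A_x`, which does not read `σ_x`
(`y ≠ x`, and `A_x` reads `K + x ∌ x` because `0 ∉ K`; `plusExpect_score_mul_eq_zero`). [folklore] -/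
theorem cov_offdiag {d : ℕ} {β : ℝ} (hβ : 0 ≤ β) {K : Finset (Site d)}
    {A : SpinConfig (Site d) → ℝ} (hK : (0 : Site d) ∉ K) (hA : DependsOn A (↑K : Set (Site d)))
    {x y : Site d} (hxy : y ≠ x) :
    plusExpect d β 0 (fun σ => spinAt y σ * (A (fun z => σ (z + x)) *
        (spinAt x σ - Real.tanh (β * ∑ w ∈ (zdGraph d).neighborFinset x, spinAt w σ)))) = 0 := by
  have hg : DependsOn (fun σ : SpinConfig (Site d) => spinAt y σ * A (fun z => σ (z + x)))
      (↑({y} ∪ K.image (· + x)) : Set (Site d)) :=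
    cov_dependsOn_mul (cov_dependsOn_spinAt y) (dependsOn_comp_add K hA x)
  have hx : x ∉ {y} ∪ K.image (· + x) := fun h => by
    rcases Finset.mem_union.1 h with h | h
    · exact hxy (Finset.mem_singleton.1 h).symm
    · obtain ⟨k, hk, hkx⟩ := Finset.mem_image.1 h
      have hkx : k + x = x := hkx
      rw [add_eq_right.1 hkx] at hk
      exact hK hk
  have e : (fun σ : SpinConfig (Site d) => spinAt y σ * (A (fun z => σ (z + x)) *
        (spinAt x σ - Real.tanh (β * ∑ w ∈ (zdGraph d).neighborFinset x, spinAt w σ)))) =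
      fun σ => (spinAt x σ - Real.tanh (β * ∑ w ∈ (zdGraph d).neighborFinset x, spinAt w σ)) *
        (spinAt y σ * A (fun z => σ (z + x))) := funext fun σ => by ring
  rw [e]
  exact plusExpect_score_mul_eq_zero hβ x hg hx

/-- **Diagonal terms**: `⟨σ_x A_x g_x⟩⁺_{β,0} = ⟨A (1 − tanh(β S_0)²)⟩⁺_{β,0}`. Since `σ_x² = 1`,
`σ_x A_x g_x = A_x − σ_x (t_x A_x)`; the heat-bath identity (`plusExpect_spinAt_mul_eq_tanh`; `t_x A_x`
does not read `σ_x`: no loops in `ℤ^d`, and `0 ∉ K`) turns `⟨σ_x t_x A_x⟩` into `⟨t_x² A_x⟩`, so the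
term is `⟨A_x (1 − t_x²)⟩`, which is `⟨A (1 − t_0²)⟩` by translation invariance
(`plusExpect_comp_add`). [folklore] -/
theorem cov_diag {d : ℕ} {β : ℝ} (hβ : 0 ≤ β) {K : Finset (Site d)}
    {A : SpinConfig (Site d) → ℝ} (hK : (0 : Site d) ∉ K) (hA : DependsOn A (↑K : Set (Site d)))
    (x : Site d) :
    plusExpect d β 0 (fun σ => spinAt x σ * (A (fun z => σ (z + x)) *
        (spinAt x σ - Real.tanh (β * ∑ w ∈ (zdGraph d).neighborFinset x, spinAt w σ)))) =
      plusExpect d β 0 (fun σ => A σ *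
        (1 - Real.tanh (β * ∑ w ∈ (zdGraph d).neighborFinset 0, spinAt w σ) ^ 2)) := by
  obtain ⟨μ, _, -, -, -, hμE⟩ := exists_plusMeasure_integral_eq_plusExpect (d := d) hβ 0
  -- supports of the local observables involved
  have hAx : DependsOn (fun σ : SpinConfig (Site d) => A (fun z => σ (z + x)))
      (↑(K.image (· + x)) : Set (Site d)) := dependsOn_comp_add K hA x
  have ht := cov_dependsOn_tanh β x
  have htA : DependsOn (fun σ : SpinConfig (Site d) =>
      Real.tanh (β * ∑ w ∈ (zdGraph d).neighborFinset x, spinAt w σ) * A (fun z => σ (z + x)))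
      (↑((zdGraph d).neighborFinset x ∪ K.image (· + x)) : Set (Site d)) :=
    cov_dependsOn_mul ht hAx
  have hsA : DependsOn (fun σ : SpinConfig (Site d) => spinAt x σ *
      (Real.tanh (β * ∑ w ∈ (zdGraph d).neighborFinset x, spinAt w σ) * A (fun z => σ (z + x))))
      (↑({x} ∪ ((zdGraph d).neighborFinset x ∪ K.image (· + x))) : Set (Site d)) :=
    cov_dependsOn_mul (cov_dependsOn_spinAt x) htA
  have httA : DependsOn (fun σ : SpinConfig (Site d) =>
      Real.tanh (β * ∑ w ∈ (zdGraph d).neighborFinset x, spinAt w σ) *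
        (Real.tanh (β * ∑ w ∈ (zdGraph d).neighborFinset x, spinAt w σ) * A (fun z => σ (z + x))))
      (↑((zdGraph d).neighborFinset x ∪ ((zdGraph d).neighborFinset x ∪ K.image (· + x))) :
        Set (Site d)) :=
    cov_dependsOn_mul ht htA
  have hdiff : DependsOn (fun σ : SpinConfig (Site d) => A (fun z => σ (z + x)) - spinAt x σ *
      (Real.tanh (β * ∑ w ∈ (zdGraph d).neighborFinset x, spinAt w σ) * A (fun z => σ (z + x))))
      (↑(K.image (· + x) ∪ ({x} ∪ ((zdGraph d).neighborFinset x ∪ K.image (· + x)))) :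
        Set (Site d)) :=
    cov_dependsOn_sub hAx hsA
  have hdiff' : DependsOn (fun σ : SpinConfig (Site d) => A (fun z => σ (z + x)) -
      Real.tanh (β * ∑ w ∈ (zdGraph d).neighborFinset x, spinAt w σ) *
        (Real.tanh (β * ∑ w ∈ (zdGraph d).neighborFinset x, spinAt w σ) * A (fun z => σ (z + x))))
      (↑(K.image (· + x) ∪ ((zdGraph d).neighborFinset x ∪
        ((zdGraph d).neighborFinset x ∪ K.image (· + x)))) : Set (Site d)) :=
    cov_dependsOn_sub hAx httA
  have h0 : DependsOn (fun σ : SpinConfig (Site d) => A σ *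
      (1 - Real.tanh (β * ∑ w ∈ (zdGraph d).neighborFinset 0, spinAt w σ) ^ 2))
      (↑(K ∪ (zdGraph d).neighborFinset 0) : Set (Site d)) := fun σ τ hst => by
    have e := cov_dependsOn_tanh β 0 fun i hi =>
      hst i (Finset.mem_coe.2 (Finset.mem_union_right _ (Finset.mem_coe.1 hi)))
    dsimp only at e ⊢
    rw [hA fun i hi => hst i (Finset.mem_coe.2 (Finset.mem_union_left _ (Finset.mem_coe.1 hi))), e]
  -- `t_x A_x` does not read `σ_x`
  have hx : x ∉ (zdGraph d).neighborFinset x ∪ K.image (· + x) := fun h => by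
    rcases Finset.mem_union.1 h with h | h
    · exact SimpleGraph.notMem_neighborFinset_self _ _ h
    · obtain ⟨k, hk, hkx⟩ := Finset.mem_image.1 h
      have hkx : k + x = x := hkx
      rw [add_eq_right.1 hkx] at hk
      exact hK hk
  -- heat-bath: `⟨σ_x t_x A_x⟩ = ⟨t_x² A_x⟩`
  have hb := plusExpect_spinAt_mul_eq_tanh hβ x htA hx
  rw [hμE _ _ hsA, hμE _ _ httA] at hb
  -- pointwise identities
  have e1 : (fun σ : SpinConfig (Site d) => spinAt x σ * (A (fun z => σ (z + x)) *
        (spinAt x σ - Real.tanh (β * ∑ w ∈ (zdGraph d).neighborFinset x, spinAt w σ)))) =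
      fun σ => A (fun z => σ (z + x)) - spinAt x σ *
        (Real.tanh (β * ∑ w ∈ (zdGraph d).neighborFinset x, spinAt w σ) *
          A (fun z => σ (z + x))) := by
    funext σ
    linear_combination (A (fun z => σ (z + x))) * spinAt_mul_self x σ
  have e2 : (fun σ : SpinConfig (Site d) => A (fun z => σ (z + x)) -
      Real.tanh (β * ∑ w ∈ (zdGraph d).neighborFinset x, spinAt w σ) *
        (Real.tanh (β * ∑ w ∈ (zdGraph d).neighborFinset x, spinAt w σ) *
          A (fun z => σ (z + x)))) =
      fun σ => A (fun z => σ (z + x)) *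
        (1 - Real.tanh (β * ∑ w ∈ (zdGraph d).neighborFinset x, spinAt w σ) ^ 2) := by
    funext σ
    ring
  have e3 : (fun σ : SpinConfig (Site d) => A (fun z => σ (z + x)) *
        (1 - Real.tanh (β * ∑ w ∈ (zdGraph d).neighborFinset x, spinAt w σ) ^ 2)) =
      fun σ => A (fun z => σ (z + x)) *
        (1 - Real.tanh (β * ∑ w ∈ (zdGraph d).neighborFinset 0,
          spinAt w (fun z => σ (z + x))) ^ 2) := by
    funext σ
    rw [sum_neighborFinset_zdGraph_eq_sum_add x (fun w => spinAt w σ)]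
    rfl
  calc plusExpect d β 0 (fun σ => spinAt x σ * (A (fun z => σ (z + x)) *
          (spinAt x σ - Real.tanh (β * ∑ w ∈ (zdGraph d).neighborFinset x, spinAt w σ))))
      = plusExpect d β 0 (fun σ => A (fun z => σ (z + x)) - spinAt x σ *
          (Real.tanh (β * ∑ w ∈ (zdGraph d).neighborFinset x, spinAt w σ) *
            A (fun z => σ (z + x)))) := by rw [e1]
    _ = ∫ σ, A (fun z => σ (z + x)) ∂μ - ∫ σ, spinAt x σ *
          (Real.tanh (β * ∑ w ∈ (zdGraph d).neighborFinset x, spinAt w σ) *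
            A (fun z => σ (z + x))) ∂μ := by
        rw [hμE _ _ hdiff, integral_sub (integrable_of_dependsOn_finset μ _ hAx)
          (integrable_of_dependsOn_finset μ _ hsA)]
    _ = ∫ σ, A (fun z => σ (z + x)) ∂μ -
          ∫ σ, Real.tanh (β * ∑ w ∈ (zdGraph d).neighborFinset x, spinAt w σ) *
            (Real.tanh (β * ∑ w ∈ (zdGraph d).neighborFinset x, spinAt w σ) *
              A (fun z => σ (z + x))) ∂μ := by rw [hb]
    _ = plusExpect d β 0 (fun σ => A (fun z => σ (z + x)) *
          (1 - Real.tanh (β * ∑ w ∈ (zdGraph d).neighborFinset x, spinAt w σ) ^ 2)) := by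
        rw [← integral_sub (integrable_of_dependsOn_finset μ _ hAx)
          (integrable_of_dependsOn_finset μ _ httA), ← hμE _ _ hdiff', e2]
    _ = plusExpect d β 0 (fun σ => A σ *
          (1 - Real.tanh (β * ∑ w ∈ (zdGraph d).neighborFinset 0, spinAt w σ) ^ 2)) := by
        rw [e3]
        exact plusExpect_comp_add hβ 0 h0 x

/-! ### The covariance identity -/

/-- **Stein covariance identity** (general `d`, `β ≥ 0`): for a local `A` reading `K ∌ 0`,
`⟨(Σ_{y∈Λ_N} σ_y) · Σ_{x∈Λ_N} A_x g_x⟩⁺_{β,0} = |Λ_N| · ⟨A (1 − tanh(β S_0)²)⟩⁺_{β,0}`: expand into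
`Σ_{y,x} ⟨σ_y A_x g_x⟩`, kill the off-diagonal terms (`cov_offdiag`) and evaluate the diagonal ones
(`cov_diag`). [folklore] -/
theorem cov_main {d : ℕ} {β : ℝ} (hβ : 0 ≤ β) {K : Finset (Site d)} {A : SpinConfig (Site d) → ℝ}
    (hK : (0 : Site d) ∉ K) (hA : DependsOn A (↑K : Set (Site d))) (N : ℕ) :
    plusExpect d β 0 (fun σ => (∑ x ∈ box d N, spinAt x σ) *
        ∑ x ∈ box d N, A (fun y => σ (y + x)) *
          (spinAt x σ - Real.tanh (β * ∑ y ∈ (zdGraph d).neighborFinset x, spinAt y σ))) =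
      (#(box d N) : ℝ) * plusExpect d β 0 (fun σ => A σ *
        (1 - Real.tanh (β * ∑ y ∈ (zdGraph d).neighborFinset 0, spinAt y σ) ^ 2)) := by
  -- support of the `(y, x)` term `σ_y A_x g_x`
  have hterm : ∀ y x : Site d, DependsOn (fun σ : SpinConfig (Site d) => spinAt y σ *
      (A (fun z => σ (z + x)) *
        (spinAt x σ - Real.tanh (β * ∑ w ∈ (zdGraph d).neighborFinset x, spinAt w σ))))
      (↑({y} ∪ (K.image (· + x) ∪ ({x} ∪ (zdGraph d).neighborFinset x))) : Set (Site d)) :=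
    fun y x => cov_dependsOn_mul (cov_dependsOn_spinAt y)
      (cov_dependsOn_mul (dependsOn_comp_add K hA x)
        (cov_dependsOn_sub (cov_dependsOn_spinAt x) (cov_dependsOn_tanh β x)))
  -- expand the product of the two sums
  have e1 : (fun σ : SpinConfig (Site d) => (∑ x ∈ box d N, spinAt x σ) *
        ∑ x ∈ box d N, A (fun y => σ (y + x)) *
          (spinAt x σ - Real.tanh (β * ∑ y ∈ (zdGraph d).neighborFinset x, spinAt y σ))) =
      fun σ => ∑ y ∈ box d N, ∑ x ∈ box d N, spinAt y σ * (A (fun z => σ (z + x)) *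
        (spinAt x σ - Real.tanh (β * ∑ w ∈ (zdGraph d).neighborFinset x, spinAt w σ))) := by
    funext σ
    rw [Finset.sum_mul_sum]
  -- linearity in `y`
  have step1 : plusExpect d β 0 (fun σ => ∑ y ∈ box d N, ∑ x ∈ box d N, spinAt y σ *
        (A (fun z => σ (z + x)) *
          (spinAt x σ - Real.tanh (β * ∑ w ∈ (zdGraph d).neighborFinset x, spinAt w σ)))) =
      ∑ y ∈ box d N, plusExpect d β 0 (fun σ => ∑ x ∈ box d N, spinAt y σ *
        (A (fun z => σ (z + x)) *
          (spinAt x σ - Real.tanh (β * ∑ w ∈ (zdGraph d).neighborFinset x, spinAt w σ)))) :=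
    cov_plusExpect_finset_sum hβ 0 (box d N)
      (fun y => (box d N).biUnion fun x =>
        {y} ∪ (K.image (· + x) ∪ ({x} ∪ (zdGraph d).neighborFinset x)))
      (fun y σ => ∑ x ∈ box d N, spinAt y σ * (A (fun z => σ (z + x)) *
        (spinAt x σ - Real.tanh (β * ∑ w ∈ (zdGraph d).neighborFinset x, spinAt w σ))))
      fun y _ => cov_dependsOn_finset_sum (box d N)
        (fun x => {y} ∪ (K.image (· + x) ∪ ({x} ∪ (zdGraph d).neighborFinset x)))
        fun x _ => hterm y x
  -- linearity in `x`, then only the diagonal term survives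
  have step2 : ∀ y ∈ box d N, plusExpect d β 0 (fun σ => ∑ x ∈ box d N, spinAt y σ *
        (A (fun z => σ (z + x)) *
          (spinAt x σ - Real.tanh (β * ∑ w ∈ (zdGraph d).neighborFinset x, spinAt w σ)))) =
      plusExpect d β 0 (fun σ => A σ *
        (1 - Real.tanh (β * ∑ y ∈ (zdGraph d).neighborFinset 0, spinAt y σ) ^ 2)) := by
    intro y hy
    rw [cov_plusExpect_finset_sum hβ 0 (box d N)
        (fun x => {y} ∪ (K.image (· + x) ∪ ({x} ∪ (zdGraph d).neighborFinset x)))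
        (fun x σ => spinAt y σ * (A (fun z => σ (z + x)) *
          (spinAt x σ - Real.tanh (β * ∑ w ∈ (zdGraph d).neighborFinset x, spinAt w σ))))
        fun x _ => hterm y x,
      Finset.sum_eq_single_of_mem y hy fun x _ hxy => cov_offdiag hβ hK hA (Ne.symm hxy)]
    exact cov_diag hβ hK hA y
  rw [e1, step1, Finset.sum_congr rfl step2, Finset.sum_const, nsmul_eq_mul]

/-- **S1 — Stein covariance identity** `⟨M_N · Σ_{x∈Λ_N} Ψ^A_x⟩ = |Λ_N| · c_A` at `β = β_c(3)` on
`ℤ³` (card Lemma 2, first half of the Cramér–Rao floor): for a local functional `A` reading the finite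
set `K ∌ 0`, with `A_x σ = A (σ(· + x))`, score `g_x = σ_x − tanh(β_c S_x)`, Stein field
`Ψ^A_x = A_x g_x`, block spin `M_N = Σ_{y∈Λ_N} σ_y` and coupling `c_A = ⟨A (1 − tanh(β_c S_0)²)⟩`.
Heat-bath (one-site DLR) identity plus translation invariance of the plus state (`cov_main`). [folklore] -/
theorem stub_steinCovariance :
    ∀ (K : Finset (Site 3)) (A : SpinConfig (Site 3) → ℝ), (0 : Site 3) ∉ K →
      DependsOn A (↑K : Set (Site 3)) → ∀ N : ℕ,
        plusExpect 3 (criticalBeta 3) 0 (fun σ => (∑ x ∈ box 3 N, spinAt x σ) *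
            ∑ x ∈ box 3 N, A (fun y => σ (y + x)) *
              (spinAt x σ - Real.tanh (criticalBeta 3 *
                ∑ y ∈ (zdGraph 3).neighborFinset x, spinAt y σ))) =
          (#(box 3 N) : ℝ) * plusExpect 3 (criticalBeta 3) 0 (fun σ => A σ *
            (1 - Real.tanh (criticalBeta 3 *
              ∑ y ∈ (zdGraph 3).neighborFinset 0, spinAt y σ) ^ 2)) :=
  fun _ _ hK hA N => cov_main (criticalBeta_nonneg 3) hK hA N

end Summit.CriticalPhenomena.Ising3DConformalLimit.SubPtolemyFloorStein

end
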